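import Summits.QuantumFields.YangMills.Theorems.GronwallGapContinuumFromLatticeGapDecayOfUniformExpansion
import Summits.QuantumFields.YangMills.Theorems.GronwallGapContinuumFromLatticeGapStubChordTwoCase
import Summits.QuantumFields.YangMills.Theorems.GronwallGapContinuumFromLatticeGapStubRpSeminorm
import HarnessLib

/-!
# `ContinuumFromLatticeGap` (stmt-QuantumFields-15915), line `registered`, reshape 6: tools of the new decay leg

Support file for the crux item stmt-QuantumFields-15915 (`GronwallGap.ContinuumFromLatticeGap`), reshape 6 of line
`registered` (the RP-spectral conjunct (b) eliminated).  Four tools of `decay_separated_uniform`: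

* `corr_chord_of_expansion` — THE ABSTRACT CORE: for a positive-time cylinder observable `F'` on the odd torus `2S+1`
  (`S ≥ 2w+8`, `β ≥ 0`) written as a finite real combination `Σ cᵢ Mᵢ` of positive-time cylinder observables whose reflected
  diagonal far values obey `corr(Mᵢ∘Θ, Mᵢ; S) ≤ C e^{−μS}`, and `Σ|cᵢ| ≤ X`:
  `corr(F'∘Θ, F'; j) ≤ e^{−(μ/2) j} corr(F'∘Θ, F'; 0) + max 1 (X² C) e^{−(μ/2) S}` for all `j ≤ S` — positivity and
  log-convexity of the landed RP core (`RpCoreA.corr_nonneg/corr_logConvex`), Minkowski (`stub_rpSeminorm`) for the far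
  value, and the two-case chord (`stub_chordTwoCase`); registered in closed form as `stub_corrChordOfExpansion`;
* `err_tendsto_zero` — the error term dies once the volumes absorb the constants;
* `coeff_mass_le` — the `ℓ¹` mass of the coefficients of the expansion of the renormalised smeared plane-string functional;
* `eventually_geometry` — the eventual admissibility of slab height and lattice time on the scheme's torus.

No definitions, no named facts.  Refs: OsterwalderSeiler1978 §2; GlimmJaffe1987 §6.1, §19.7.
-/

noncomputable section

open scoped SchwartzMap BigOperators ComplexConjugate
open MeasureTheory Filter Topology
open Literature.MathematicalPhysics.QuantumFieldTheory Literature.MathematicalPhysics.QuantumLattice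
open Literature.MathematicalPhysics.AQFT
open Literature.Probability.LatticeModels (box Site mem_box)
open Summit.QuantumFields.YangMills.Cruxes.OSLegsFromFemtoAndGap.DlrCollarTransfer (plane)
open Summit.QuantumFields.YangMills.Theorems.WeakCouplingHypercubicLimit.TraceNormColdPressure
open Summit.QuantumFields.YangMills.Theorems.ContinuumLegGivenGap

namespace Summit.QuantumFields.YangMills.Theorems.ContinuumFromLatticeGap

variable {G : Type} [Group G] [TopologicalSpace G] [IsTopologicalGroup G] [CompactSpace G]
  [MeasurableSpace G] [BorelSpace G]

/-! ### The abstract core: chord + Minkowski + far values -/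

/-- **Chord bound for an expanded positive-time observable.**  On the odd torus `2S+1` (`S ≥ 2w+8`, `0 < S`, `β ≥ 0`), let
`F'` be a real bounded measurable cylinder observable based at times `0 ≤ x₀ ≤ w`, equal to the finite real combination
`Σ_{i∈s} cᵢ Mᵢ` of such observables; if `Σ|cᵢ| ≤ X` and every reflected diagonal far value satisfies
`corr(Mᵢ∘Θ, Mᵢ; S) ≤ C e^{−μS}` (`μ, C ≥ 0`), then for all `j ≤ S`:
`corr(F'∘Θ, F'; j) ≤ e^{−(μ/2) j} corr(F'∘Θ, F'; 0) + max 1 (X² C) · e^{−(μ/2) S}`. [folklore] -/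
theorem corr_chord_of_expansion (r : LatticeRep G) {β : ℝ} (hβ : 0 ≤ β) (S w : ℕ) (hS : 2 * w + 8 ≤ S) (hS0 : 0 < S)
    {F' : LGConfig 4 G → ℝ} {Λ : Finset (Literature.MathematicalPhysics.QuantumLattice.ZdEdge 4)}
    (hFm : Measurable F') (hFb : ∃ C : ℝ, ∀ U, |F' U| ≤ C) (hFc : IsCylinder F' Λ)
    (htF : ∀ e ∈ Λ, 0 ≤ e.1 0 ∧ e.1 0 ≤ (w : ℤ))
    {ι : Type} (s : Finset ι) (c : ι → ℝ) (Mo : ι → LGConfig 4 G → ℝ)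
    (Λm : ι → Finset (Literature.MathematicalPhysics.QuantumLattice.ZdEdge 4))
    (hMm : ∀ i ∈ s, Measurable (Mo i)) (hMb : ∀ i ∈ s, ∃ C : ℝ, ∀ U, |Mo i U| ≤ C)
    (hMc : ∀ i ∈ s, IsCylinder (Mo i) (Λm i)) (htM : ∀ i ∈ s, ∀ e ∈ Λm i, 0 ≤ e.1 0 ∧ e.1 0 ≤ (w : ℤ))
    (hexp : F' = fun V => ∑ i ∈ s, c i * Mo i V)
    {μ C X : ℝ} (hμ : 0 ≤ μ) (hC : 0 ≤ C) (hX : ∑ i ∈ s, |c i| ≤ X)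
    (hfar : ∀ i ∈ s, latticeConnectedCorr r.ρ β (2 * S + 1) (Mo i ∘ gaugeTimeReflect) (Mo i) S ≤ C * Real.exp (-(μ * S)))
    (j : ℕ) (hj : j ≤ S) :
    latticeConnectedCorr r.ρ β (2 * S + 1) (F' ∘ gaugeTimeReflect) F' j ≤
      Real.exp (-(μ / 2 * j)) * latticeConnectedCorr r.ρ β (2 * S + 1) (F' ∘ gaugeTimeReflect) F' 0 +
        max 1 (X ^ 2 * C) * Real.exp (-(μ / 2 * S)) := by
  -- positivity and log-convexity (the landed RP core)
  have hnonneg : ∀ k : ℕ, k ≤ S → 0 ≤ latticeConnectedCorr r.ρ β (2 * S + 1) (F' ∘ gaugeTimeReflect) F' k :=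
    fun k hk => RpCoreA.corr_nonneg r hβ S w hS hFm hFb hFc htF k hk
  have hlc : ∀ k : ℕ, 1 ≤ k → k + 1 ≤ S →
      latticeConnectedCorr r.ρ β (2 * S + 1) (F' ∘ gaugeTimeReflect) F' k ^ 2 ≤
        latticeConnectedCorr r.ρ β (2 * S + 1) (F' ∘ gaugeTimeReflect) F' (k - 1) *
          latticeConnectedCorr r.ρ β (2 * S + 1) (F' ∘ gaugeTimeReflect) F' (k + 1) :=
    fun k hk1 hk => RpCoreA.corr_logConvex r hβ S w hS hFm hFb hFc htF k hk1 hk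
  -- Minkowski over the expansion, each term by its far value
  have hX0 : 0 ≤ X := (Finset.sum_nonneg fun i _ => abs_nonneg (c i)).trans hX
  have hsemi : Real.sqrt (latticeConnectedCorr r.ρ β (2 * S + 1) (F' ∘ gaugeTimeReflect) F' S) ≤
      ∑ i ∈ s, |c i| * Real.sqrt (latticeConnectedCorr r.ρ β (2 * S + 1) (Mo i ∘ gaugeTimeReflect) (Mo i) S) := by
    rw [hexp]
    exact stub_rpSeminorm G r β hβ S w hS ι s Mo c Λm hMm hMb hMc htM S le_rfl
  have hsum : ∑ i ∈ s, |c i| * Real.sqrt (latticeConnectedCorr r.ρ β (2 * S + 1) (Mo i ∘ gaugeTimeReflect) (Mo i) S) ≤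
      X * Real.sqrt (C * Real.exp (-(μ * S))) := by
    calc ∑ i ∈ s, |c i| * Real.sqrt (latticeConnectedCorr r.ρ β (2 * S + 1) (Mo i ∘ gaugeTimeReflect) (Mo i) S)
        ≤ ∑ i ∈ s, |c i| * Real.sqrt (C * Real.exp (-(μ * S))) :=
          Finset.sum_le_sum fun i hi => mul_le_mul_of_nonneg_left (Real.sqrt_le_sqrt (hfar i hi)) (abs_nonneg _)
      _ = (∑ i ∈ s, |c i|) * Real.sqrt (C * Real.exp (-(μ * S))) := (Finset.sum_mul _ _ _).symm
      _ ≤ X * Real.sqrt (C * Real.exp (-(μ * S))) := mul_le_mul_of_nonneg_right hX (Real.sqrt_nonneg _)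
  have hCe : 0 ≤ C * Real.exp (-(μ * S)) := mul_nonneg hC (Real.exp_pos _).le
  have hfarF : latticeConnectedCorr r.ρ β (2 * S + 1) (F' ∘ gaugeTimeReflect) F' S ≤
      max 1 (X ^ 2 * C) * Real.exp (-(μ * S)) := by
    calc latticeConnectedCorr r.ρ β (2 * S + 1) (F' ∘ gaugeTimeReflect) F' S
        = Real.sqrt (latticeConnectedCorr r.ρ β (2 * S + 1) (F' ∘ gaugeTimeReflect) F' S) ^ 2 :=
          (Real.sq_sqrt (hnonneg S le_rfl)).symm
      _ ≤ (X * Real.sqrt (C * Real.exp (-(μ * S)))) ^ 2 := pow_le_pow_left₀ (Real.sqrt_nonneg _) (hsemi.trans hsum) 2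
      _ = X ^ 2 * C * Real.exp (-(μ * S)) := by rw [mul_pow, Real.sq_sqrt hCe]; ring
      _ ≤ max 1 (X ^ 2 * C) * Real.exp (-(μ * S)) := mul_le_mul_of_nonneg_right (le_max_right _ _) (Real.exp_pos _).le
  -- the two-case chord
  have hDpos : 0 < max 1 (X ^ 2 * C) := lt_of_lt_of_le one_pos (le_max_left _ _)
  have h := stub_chordTwoCase (fun k => latticeConnectedCorr r.ρ β (2 * S + 1) (F' ∘ gaugeTimeReflect) F' k) S _ μ (μ / 2)
    hS0 hDpos (by positivity) (by linarith) hnonneg hlc hfarF j hj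
  have hring : -((μ - μ / 2) * (S : ℝ)) = -(μ / 2 * S) := by ring
  rw [hring] at h
  exact h

/-- **Registered sub-goal `stub_corrChordOfExpansion`** (line `registered`, reshape 6): `corr_chord_of_expansion` in closed
form. [folklore] -/
theorem stub_corrChordOfExpansion :
    ∀ (G : Type) [Group G] [TopologicalSpace G] [IsTopologicalGroup G] [CompactSpace G]
      [MeasurableSpace G] [BorelSpace G] (r : LatticeRep G) (β : ℝ), 0 ≤ β → ∀ (S w : ℕ), 2 * w + 8 ≤ S → 0 < S →
      ∀ (F' : LGConfig 4 G → ℝ) (Λ : Finset (Literature.MathematicalPhysics.QuantumLattice.ZdEdge 4)),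
      Measurable F' → (∃ C : ℝ, ∀ U, |F' U| ≤ C) → IsCylinder F' Λ → (∀ e ∈ Λ, 0 ≤ e.1 0 ∧ e.1 0 ≤ (w : ℤ)) →
      ∀ (ι : Type) (s : Finset ι) (c : ι → ℝ) (Mo : ι → LGConfig 4 G → ℝ)
        (Λm : ι → Finset (Literature.MathematicalPhysics.QuantumLattice.ZdEdge 4)),
      (∀ i ∈ s, Measurable (Mo i)) → (∀ i ∈ s, ∃ C : ℝ, ∀ U, |Mo i U| ≤ C) → (∀ i ∈ s, IsCylinder (Mo i) (Λm i)) →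
      (∀ i ∈ s, ∀ e ∈ Λm i, 0 ≤ e.1 0 ∧ e.1 0 ≤ (w : ℤ)) → (F' = fun V => ∑ i ∈ s, c i * Mo i V) →
      ∀ (μ C X : ℝ), 0 ≤ μ → 0 ≤ C → ∑ i ∈ s, |c i| ≤ X →
      (∀ i ∈ s, latticeConnectedCorr r.ρ β (2 * S + 1) (Mo i ∘ gaugeTimeReflect) (Mo i) S ≤ C * Real.exp (-(μ * S))) →
      ∀ j : ℕ, j ≤ S →
        latticeConnectedCorr r.ρ β (2 * S + 1) (F' ∘ gaugeTimeReflect) F' j ≤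
          Real.exp (-(μ / 2 * j)) * latticeConnectedCorr r.ρ β (2 * S + 1) (F' ∘ gaugeTimeReflect) F' 0 +
            max 1 (X ^ 2 * C) * Real.exp (-(μ / 2 * S)) :=
  fun _ _ _ _ _ _ _ r _ hβ S w hS hS0 _ _ hFm hFb hFc htF _ s c Mo Λm hMm hMb hMc htM hexp _ _ _ hμ hC hX hfar j hj =>
    corr_chord_of_expansion r hβ S w hS hS0 hFm hFb hFc htF s c Mo Λm hMm hMb hMc htM hexp hμ hC hX hfar j hj

/-! ### The error term -/

omit [Group G] [TopologicalSpace G] [IsTopologicalGroup G] [CompactSpace G] [MeasurableSpace G] [BorelSpace G] in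
/-- **The error term of the chord dies**: if `ε_k := (log C_k + |log a_k|)/(a_k L_k) → 0` with `C_k ≥ 1`, `0 < a_k ≤ 1`,
`a_k L_k → ∞`, then for all constants `K`, `Q : ℕ`, `Δ > 0`:
`max 1 ((K (a_k⁻¹)^Q)² C_k) · e^{−(Δ/2) a_k L_k} → 0`. [folklore] -/
theorem err_tendsto_zero {a C : ℕ → ℝ} {L : ℕ → ℕ} (ha : ∀ k, 0 < a k) (ha1 : ∀ᶠ k in atTop, a k ≤ 1)
    (hC : ∀ k, 1 ≤ C k) (haL : Tendsto (fun k => a k * (L k : ℝ)) atTop atTop)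
    (hε : Tendsto (fun k => (Real.log (C k) + |Real.log (a k)|) / (a k * (L k : ℝ))) atTop (𝓝 0))
    (K : ℝ) (Q : ℕ) {Δ : ℝ} (hΔ : 0 < Δ) :
    Tendsto (fun k => max 1 ((K * (a k)⁻¹ ^ Q) ^ 2 * C k) * Real.exp (-(Δ / 2 * (a k * (L k : ℝ))))) atTop (𝓝 0) := by
  -- eventually `(2Q + 1) ε_k ≤ Δ/4`
  have hQ : (0 : ℝ) < 2 * Q + 1 := by positivity
  have hsmall : ∀ᶠ k in atTop, (2 * Q + 1) * ((Real.log (C k) + |Real.log (a k)|) / (a k * (L k : ℝ))) ≤ Δ / 4 := by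
    have h := hε.const_mul ((2 : ℝ) * Q + 1)
    rw [mul_zero] at h
    exact h.eventually (ge_mem_nhds (by positivity))
  have haLpos : ∀ᶠ k in atTop, 1 ≤ a k * (L k : ℝ) := haL.eventually_ge_atTop 1
  -- the comparison `err_k ≤ (1 + K²) e^{−(Δ/4) a_k L_k}`
  have hle : ∀ᶠ k in atTop, max 1 ((K * (a k)⁻¹ ^ Q) ^ 2 * C k) * Real.exp (-(Δ / 2 * (a k * (L k : ℝ)))) ≤
      (1 + K ^ 2) * Real.exp (-(Δ / 4 * (a k * (L k : ℝ)))) := by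
    filter_upwards [hsmall, haLpos, ha1] with k hk hkL hk1
    have hak := ha k
    have hx : 0 < a k * (L k : ℝ) := lt_of_lt_of_le one_pos hkL
    have hCk := hC k
    have hlogC : 0 ≤ Real.log (C k) := Real.log_nonneg hCk
    have hloga : |Real.log (a k)| = -Real.log (a k) := abs_of_nonpos (Real.log_nonpos hak.le hk1)
    -- `(a⁻¹)^Q = exp(Q |log a|)` and `C = exp(log C)`
    have hP : (a k)⁻¹ ^ Q = Real.exp (Q * |Real.log (a k)|) := by
      rw [hloga, ← Real.log_inv, ← Real.log_pow, Real.exp_log (pow_pos (inv_pos.2 hak) Q)]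
    have hCexp : C k = Real.exp (Real.log (C k)) := (Real.exp_log (lt_of_lt_of_le one_pos hCk)).symm
    -- the key exponent inequality
    have hkey : 2 * (Q * |Real.log (a k)|) + Real.log (C k) ≤ Δ / 4 * (a k * (L k : ℝ)) := by
      have h1 : (2 * Q + 1) * (Real.log (C k) + |Real.log (a k)|) ≤ Δ / 4 * (a k * (L k : ℝ)) := by
        have h := hk
        rw [← mul_div_assoc, div_le_iff₀ hx] at h
        exact h
      have h2 : 0 ≤ |Real.log (a k)| := abs_nonneg _
      nlinarith
    have hmax : max 1 ((K * (a k)⁻¹ ^ Q) ^ 2 * C k) ≤ (1 + K ^ 2) * Real.exp (Δ / 4 * (a k * (L k : ℝ))) := by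
      refine max_le ?_ ?_
      · calc (1 : ℝ) ≤ 1 * Real.exp (Δ / 4 * (a k * (L k : ℝ))) := by
              rw [one_mul]; exact Real.one_le_exp (by positivity)
          _ ≤ (1 + K ^ 2) * Real.exp (Δ / 4 * (a k * (L k : ℝ))) := by gcongr; nlinarith
      · rw [hP, mul_pow, hCexp]
        have hEE : Real.exp (↑Q * |Real.log (a k)|) ^ 2 * Real.exp (Real.log (C k)) =
            Real.exp (2 * (Q * |Real.log (a k)|) + Real.log (C k)) := by
          rw [← Real.exp_nat_mul, ← Real.exp_add]; push_cast; ring_nf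
        calc K ^ 2 * Real.exp (↑Q * |Real.log (a k)|) ^ 2 * Real.exp (Real.log (C k))
            = K ^ 2 * Real.exp (2 * (Q * |Real.log (a k)|) + Real.log (C k)) := by rw [mul_assoc, hEE]
          _ ≤ K ^ 2 * Real.exp (Δ / 4 * (a k * (L k : ℝ))) := by gcongr
          _ ≤ (1 + K ^ 2) * Real.exp (Δ / 4 * (a k * (L k : ℝ))) := by gcongr; linarith
    calc max 1 ((K * (a k)⁻¹ ^ Q) ^ 2 * C k) * Real.exp (-(Δ / 2 * (a k * (L k : ℝ))))
        ≤ (1 + K ^ 2) * Real.exp (Δ / 4 * (a k * (L k : ℝ))) * Real.exp (-(Δ / 2 * (a k * (L k : ℝ)))) :=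
          mul_le_mul_of_nonneg_right hmax (Real.exp_pos _).le
      _ = (1 + K ^ 2) * Real.exp (-(Δ / 4 * (a k * (L k : ℝ)))) := by
          rw [mul_assoc, ← Real.exp_add]; congr 2; ring
  -- squeeze
  have hlim : Tendsto (fun k => (1 + K ^ 2) * Real.exp (-(Δ / 4 * (a k * (L k : ℝ))))) atTop (𝓝 0) := by
    have h1 : Tendsto (fun k => -(Δ / 4 * (a k * (L k : ℝ)))) atTop atBot :=
      tendsto_neg_atTop_atBot.comp (haL.const_mul_atTop (by positivity))
    have h2 := Real.tendsto_exp_atBot.comp h1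
    simpa using h2.const_mul (1 + K ^ 2)
  refine tendsto_of_tendsto_of_tendsto_of_le_of_le' tendsto_const_nhds hlim
    (Eventually.of_forall fun k => by positivity) hle

/-! ### The `ℓ¹` mass of the coefficients -/

/-- **Coefficient mass of the expansion of the renormalised smeared plane-string functional**: with polynomial
renormalisation `|c_k| ≤ a_k^{−Q}`, a bounded counterterm `|m_k| ≤ C_m`, `a_k ≤ 1` and a test function supported in the closed
`ρ`-ball, the coefficients `Re((c_k a_k⁴)ⁿ F(a_k y)) ∏_{l∉s}(−m_k/6)` over valid `q`, good `y` (box of size `d`) and `s ⊆ [n]` have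
`ℓ¹` mass at most `6ⁿ 2ⁿ (max 1 (C_m/6))ⁿ (2ρ+3)^{4n} ‖F‖₀₀ · a_k^{−Qn}`. [folklore] -/
theorem coeff_mass_le (r : LatticeRep G) (sch : SpeciesScheme (YMSpecies G)) {n : ℕ}
    (F : 𝓢((Fin n → EuclideanSpace ℝ (Fin 4)), ℂ)) {ρ : ℝ} (hρ : 0 ≤ ρ)
    (hFρ : tsupport (F : (Fin n → EuclideanSpace ℝ (Fin 4)) → ℂ) ⊆ Metric.closedBall 0 ρ)
    {Qr : ℕ} (hQr : ∀ k, |sch.c r.curvature k| ≤ (sch.a k)⁻¹ ^ Qr) {Cm : ℝ} (hCm : ∀ k, |sch.m r.curvature k| ≤ Cm)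
    (k : ℕ) (hak : sch.a k ≤ 1) (d : ℕ) :
    ∑ i ∈ (Fintype.piFinset fun _ : Fin n => Finset.univ.filter fun p : Fin 4 × Fin 4 => p.1 < p.2) ×ˢ
        ((Fintype.piFinset fun _ : Fin n =>
            (Fintype.piFinset fun _ : Fin 4 => Finset.Icc (-(d : ℤ)) d).filter
              fun y : Site 4 => 1 ≤ y 0 ∧ y 0 + 1 ≤ (d : ℤ)) ×ˢ (Finset.univ : Finset (Fin n)).powerset),
      |(((((sch.c r.curvature k * sch.a k ^ 4) ^ n : ℝ) : ℂ) • F) (fun l => sch.a k • siteToE (i.2.1 l))).re *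
          ∏ _l ∈ Finset.univ \ i.2.2, (-(sch.m r.curvature k / 6))| ≤
      (6 ^ n * 2 ^ n * max 1 (Cm / 6) ^ n * ((2 * ρ + 3) ^ (4 * n) * SchwartzMap.seminorm ℂ 0 0 F)) *
        (sch.a k)⁻¹ ^ (Qr * n) := by
  classical
  have ha := sch.a_pos k
  -- the support of the renormalised test function
  have hsupp : tsupport (((((sch.c r.curvature k * sch.a k ^ 4) ^ n : ℝ) : ℂ) • F :
      𝓢((Fin n → EuclideanSpace ℝ (Fin 4)), ℂ)) : (Fin n → EuclideanSpace ℝ (Fin 4)) → ℂ) ⊆ Metric.closedBall 0 ρ := by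
    have hfun : (((((sch.c r.curvature k * sch.a k ^ 4) ^ n : ℝ) : ℂ) • F :
        𝓢((Fin n → EuclideanSpace ℝ (Fin 4)), ℂ)) : (Fin n → EuclideanSpace ℝ (Fin 4)) → ℂ) =
        fun u => ((((sch.c r.curvature k * sch.a k ^ 4) ^ n : ℝ) : ℂ)) * F u := rfl
    rw [hfun]
    exact (tsupport_mul_subset_right (f := fun _ => ((((sch.c r.curvature k * sch.a k ^ 4) ^ n : ℝ) : ℂ)))
      (g := (F : (Fin n → EuclideanSpace ℝ (Fin 4)) → ℂ))).trans hFρ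
  -- the mass over the box `d`
  have hmass : ∑ y ∈ Fintype.piFinset (fun _ : Fin n => box 4 d),
      ‖((((sch.c r.curvature k * sch.a k ^ 4) ^ n : ℝ) : ℂ) • F) (fun l => sch.a k • siteToE (y l))‖ ≤
      (2 * ρ + 3) ^ (4 * n) * SchwartzMap.seminorm ℂ 0 0 F * ((sch.a k)⁻¹ ^ Qr) ^ n := by
    have hsum := thermal_bookkeeping_sum_le n _ ρ (sch.a k) d ha hρ hsupp
    rw [map_smul_eq_mul, Complex.norm_real, Real.norm_eq_abs, abs_pow, abs_mul, abs_pow, abs_of_pos ha] at hsum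
    refine hsum.trans ?_
    have h1 : (2 * ρ / sch.a k + 3) ^ (4 * n) * (sch.a k ^ 4) ^ n ≤ (2 * ρ + 3) ^ (4 * n) := by
      rw [show (sch.a k ^ 4) ^ n = sch.a k ^ (4 * n) by ring, ← mul_pow]
      apply pow_le_pow_left₀ (by positivity)
      rw [add_mul, div_mul_cancel₀ _ ha.ne']
      nlinarith
    have h2 : |sch.c r.curvature k| ^ n ≤ ((sch.a k)⁻¹ ^ Qr) ^ n := pow_le_pow_left₀ (abs_nonneg _) (hQr _) n
    have h3 : 0 ≤ SchwartzMap.seminorm ℂ 0 0 F := apply_nonneg _ _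
    calc (2 * ρ / sch.a k + 3) ^ (4 * n) * ((|sch.c r.curvature k| * sch.a k ^ 4) ^ n * SchwartzMap.seminorm ℂ 0 0 F)
        = ((2 * ρ / sch.a k + 3) ^ (4 * n) * (sch.a k ^ 4) ^ n) * SchwartzMap.seminorm ℂ 0 0 F * |sch.c r.curvature k| ^ n := by
          ring
      _ ≤ (2 * ρ + 3) ^ (4 * n) * SchwartzMap.seminorm ℂ 0 0 F * ((sch.a k)⁻¹ ^ Qr) ^ n :=
          mul_le_mul (mul_le_mul_of_nonneg_right h1 h3) h2 (by positivity) (by positivity)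
  -- the good box sits inside `box d`
  have hsub : (Fintype.piFinset fun _ : Fin n =>
      (Fintype.piFinset fun _ : Fin 4 => Finset.Icc (-(d : ℤ)) d).filter fun y : Site 4 => 1 ≤ y 0 ∧ y 0 + 1 ≤ (d : ℤ)) ⊆
      Fintype.piFinset (fun _ : Fin n => box 4 d) := by
    refine Fintype.piFinset_subset _ _ fun _ y hy => ?_
    rw [Finset.mem_filter, Fintype.mem_piFinset] at hy
    rw [mem_box]
    intro i
    have h := Finset.mem_Icc.1 (hy.1 i)
    constructor <;> omega
  have h2 := Finset.sum_le_sum_of_subset_of_nonneg hsub (fun y _ _ => norm_nonneg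
    (((((sch.c r.curvature k * sch.a k ^ 4) ^ n : ℝ) : ℂ) • F) (fun l => sch.a k • siteToE (y l))))
  have hμ1 : max 1 |sch.m r.curvature k / 6| ^ n ≤ max 1 (Cm / 6) ^ n := by
    refine pow_le_pow_left₀ (le_trans zero_le_one (le_max_left _ _)) (max_le_max le_rfl ?_) n
    rw [abs_div, abs_of_pos (by norm_num : (0:ℝ) < 6)]
    exact div_le_div_of_nonneg_right (hCm _) (by norm_num)
  have hpow : ((sch.a k)⁻¹ ^ Qr) ^ n = (sch.a k)⁻¹ ^ (Qr * n) := (pow_mul _ _ _).symm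
  refine (sum_abs_coeff_le (sch.a k) _ _ _).trans ?_
  calc 6 ^ n * 2 ^ n * max 1 |sch.m r.curvature k / 6| ^ n *
        ∑ y ∈ (Fintype.piFinset fun _ : Fin n =>
          (Fintype.piFinset fun _ : Fin 4 => Finset.Icc (-(d : ℤ)) d).filter fun y : Site 4 => 1 ≤ y 0 ∧ y 0 + 1 ≤ (d : ℤ)),
          ‖((((sch.c r.curvature k * sch.a k ^ 4) ^ n : ℝ) : ℂ) • F) (fun l => sch.a k • siteToE (y l))‖
      ≤ 6 ^ n * 2 ^ n * max 1 (Cm / 6) ^ n * ((2 * ρ + 3) ^ (4 * n) * SchwartzMap.seminorm ℂ 0 0 F * ((sch.a k)⁻¹ ^ Qr) ^ n) :=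
        mul_le_mul (mul_le_mul_of_nonneg_left hμ1 (by positivity)) (h2.trans hmass)
          (Finset.sum_nonneg fun _ _ => norm_nonneg _) (by positivity)
    _ = (6 ^ n * 2 ^ n * max 1 (Cm / 6) ^ n * ((2 * ρ + 3) ^ (4 * n) * SchwartzMap.seminorm ℂ 0 0 F)) *
          (sch.a k)⁻¹ ^ (Qr * n) := by rw [hpow]; ring

/-! ### Eventual geometry on the scheme's torus -/

omit [Group G] [TopologicalSpace G] [IsTopologicalGroup G] [CompactSpace G] [MeasurableSpace G] [BorelSpace G] in
/-- **Eventual admissibility**: with `a_k L_k → ∞`, `a_k ≤ 1` eventually and lattice times `2⌊t/(2a_k)⌋` of physical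
length `≤ t`, eventually the slab height `⌊ρ/a_k⌋ + 2` is RP-admissible (`2(⌊ρ/a_k⌋+2) + 8 ≤ L_k`), the lattice time fits
(`2⌊t/(2a_k)⌋ ≤ L_k`) and `0 < L_k`. [folklore] -/
theorem eventually_geometry {a : ℕ → ℝ} {L : ℕ → ℕ} (ha : ∀ k, 0 < a k) (ha1 : ∀ᶠ k in atTop, a k ≤ 1)
    (haL : Tendsto (fun k => a k * (L k : ℝ)) atTop atTop) {ρ t : ℝ} (hρ : 0 ≤ ρ)
    (hjb : ∀ k, ((2 * ⌊t / (2 * a k)⌋₊ : ℕ) : ℝ) * a k ≤ t) :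
    ∀ᶠ k in atTop, 2 * (⌊ρ / a k⌋₊ + 2) + 8 ≤ L k ∧ 2 * ⌊t / (2 * a k)⌋₊ ≤ L k ∧ 0 < L k := by
  filter_upwards [haL.eventually (eventually_ge_atTop (2 * ρ + t + 14)), ha1] with k hk hak
  have hak0 := ha k
  have hfl : ((⌊ρ / a k⌋₊ : ℕ) : ℝ) ≤ ρ / a k := Nat.floor_le (by positivity)
  have hj := hjb k
  have h1 : (⌊ρ / a k⌋₊ : ℝ) * a k ≤ ρ := by
    have := mul_le_mul_of_nonneg_right hfl hak0.le
    rwa [div_mul_cancel₀ _ hak0.ne'] at this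
  have hL : (L k : ℝ) * a k ≥ 2 * ρ + t + 14 := by linarith [mul_comm (a k) (L k : ℝ)]
  have ht0 : 0 ≤ t := le_trans (by positivity) hj
  refine ⟨?_, ?_, ?_⟩
  · have hreal : ((2 * (⌊ρ / a k⌋₊ + 2) + 8 : ℕ) : ℝ) * a k ≤ (L k : ℝ) * a k := by push_cast; nlinarith
    exact_mod_cast le_of_mul_le_mul_right hreal hak0
  · have hreal : ((2 * ⌊t / (2 * a k)⌋₊ : ℕ) : ℝ) * a k ≤ (L k : ℝ) * a k := by push_cast at hj ⊢; nlinarith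
    exact_mod_cast le_of_mul_le_mul_right hreal hak0
  · have hreal : ((0 : ℕ) : ℝ) * a k < (L k : ℝ) * a k := by push_cast; nlinarith
    exact_mod_cast lt_of_mul_lt_mul_right hreal hak0.le

end Summit.QuantumFields.YangMills.Theorems.ContinuumFromLatticeGap

end
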